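import Literature.NumberTheory.LFunctions.JensenXiFixedDegree
import HarnessLib

/-!
# Holland's hyperbolicity wedge `n³ log²(n+2) ≥ K d⁵` for the Jensen polynomials of `ξ` — an
# UNREFEREED CLAIM (arXiv:2608.08682v1, August 2026), typed as a claim (D-0012)

J. Holland, *A new hyperbolicity wedge and a joint semicircle limit for Jensen polynomials of
Riemann's ξ-function*, arXiv:2608.08682v1 [math.NT], 9 Aug 2026 (title page dated 3 August 2026)
[Holland2026JensenWedge]. With `ξ(½ + z) = Σ γ(n) z^{2n}/n!` and
`J^{d,n}(X) = Σ_j (d choose j) γ(n+j) X^j` (his `γ = xiTaylorCoeff/8`, GORZ's normalisation being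
`(-1 + 4z²)Λ(½ + z) = 8ξ(½ + z)`; the zeros of `J^{d,n}` are the same), the preprint states:

> **Theorem 1.1 (Main theorem).** There is an absolute constant `K > 0` such that, for all
> integers `d ≥ 1` and `n ≥ 0` satisfying `n³ log²(n+2) ≥ K d⁵`, the Jensen polynomial `J^{d,n}`
> has `d` distinct negative real zeros. (p. 1)

"Thus hyperbolicity holds uniformly for `d ≤ c n^{3/5} log^{2/5}(n+2)` with a suitable absolute
`c > 0`" (p. 2). The constant is NOT computed: "Let `n₀` exceed all fixed thresholds in the
preceding lemmas. Choose `K` larger than `K₄, K₅`, the constants required in the root and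
derivative-ratio estimates, and `1 + max_{0 ≤ m < n₀} m³ log²(m+2)`. Increase it once more so that
(81) is at most `1/2` …" (§10, Proof of Theorem 1.1).

STATUS. A two-week-old preprint, unrefereed; typed here `@[claim … "under-review"]` for the
`rh-jensen` column (its WANTED W7), next to the published effective tails of
`JensenXiFixedDegree.lean` — GORTTW, Adv. Math. 397 (2022) Thm. 1.1 (`n > c·e^{d}`, journal;
`gorttw_thm1_1`) and Kim–Lee, JKMS 59 (2022) Thm. 1 (`N(d) = O(d^{1/2+ε})`, ineffective;
`kimLee_thm1`). In `d` the wedge is polynomial, `n ≥ (K/log²(n+2))^{1/3} d^{5/3}`, between those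
two. NOTHING here is asserted: `holland2026_thm1_1` is a `Prop`; the two theorems below only unfold
it into the column's currencies (`Splits`, `JensenHyperbolicFrom`). The preprint's Theorem 1.2
(joint semicircle limit of the empirical zero measure along the wedge) is not typed.

## References
* [Holland2026JensenWedge] J. Holland, arXiv:2608.08682v1 (2026), Thm. 1.1 (p. 1), §10 (proof).
* [GriffinEtAl2022], [KimLee2021] — see `JensenXiFixedDegree.lean`.
-/

noncomputable section

open Polynomial

namespace Literature.NumberTheory.LFunctions

/-- **Holland 2026 (arXiv:2608.08682v1), Theorem 1.1 — UNREFEREED CLAIM, typed, not asserted**: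
"There is an absolute constant `K > 0` such that, for all integers `d ≥ 1` and `n ≥ 0` satisfying
`n³ log²(n+2) ≥ K d⁵`, the Jensen polynomial `J^{d,n}` has `d` distinct negative real zeros."
(`J^{d,n} = jensenPoly xiTaylorCoeff d n` up to the factor `8`; "`d` distinct negative real
zeros" = the multiset of real roots has `d` elements, no repetition, all `< 0`.) `K` is absolute
but not computed in the preprint (§10). -/
@[claim "Holland2026JensenWedge" "under-review"]
def holland2026_thm1_1 : Prop :=
  ∃ K : ℝ, 0 < K ∧ ∀ d n : ℕ, 1 ≤ d →
    K * (d : ℝ) ^ 5 ≤ (n : ℝ) ^ 3 * Real.log ((n : ℝ) + 2) ^ 2 →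
      (jensenPoly xiTaylorCoeff d n).roots.card = d ∧ (jensenPoly xiTaylorCoeff d n).roots.Nodup ∧
        ∀ x ∈ (jensenPoly xiTaylorCoeff d n).roots, x < 0

/-- The claim in the currency of the tree ("hyperbolic" = `Splits` over `ℝ`): `d` real roots of a
polynomial of degree `≤ d` force splitting (`splits_iff_card_roots`). A consequence of the CLAIM
`holland2026_thm1_1`, taken as a hypothesis; nothing asserted. -/
@[claim "Holland2026JensenWedge" "under-review"]
theorem splits_of_holland2026_thm1_1 (h : holland2026_thm1_1) :
    ∃ K : ℝ, 0 < K ∧ ∀ d n : ℕ, 1 ≤ d →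
      K * (d : ℝ) ^ 5 ≤ (n : ℝ) ^ 3 * Real.log ((n : ℝ) + 2) ^ 2 →
        (jensenPoly xiTaylorCoeff d n).Splits := by
  obtain ⟨K, hK, h⟩ := h
  refine ⟨K, hK, fun d n hd hw => ?_⟩
  obtain ⟨hcard, -, -⟩ := h d n hd hw
  have hle : (jensenPoly xiTaylorCoeff d n).natDegree ≤ d := natDegree_jensenPoly_le _ d n
  have hge : (jensenPoly xiTaylorCoeff d n).roots.card ≤ (jensenPoly xiTaylorCoeff d n).natDegree :=
    card_roots' _
  exact splits_iff_card_roots.2 (by omega)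

/-- The claim as a `JensenHyperbolicFrom` tail with a polynomial hand-off shift: since
`log(n+2) ≥ log 2`, the wedge contains `n ≥ c · d^{5/3}` with `c = (K/log² 2)^{1/3}`, so
`J^{d,n}_γ` would be hyperbolic for every `n ≥ ⌈c d^{5/3}⌉`. A consequence of the CLAIM
`holland2026_thm1_1`, taken as a hypothesis; nothing asserted. -/
@[claim "Holland2026JensenWedge" "under-review"]
theorem jensenHyperbolicFrom_of_holland2026_thm1_1 (h : holland2026_thm1_1) :
    ∃ c : ℝ, 0 < c ∧ ∀ d : ℕ, 1 ≤ d →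
      JensenHyperbolicFrom xiTaylorCoeff d ⌈c * (d : ℝ) ^ ((5 : ℝ) / 3)⌉₊ := by
  obtain ⟨K, hK, h⟩ := splits_of_holland2026_thm1_1 h
  have hl2 : 0 < Real.log 2 := Real.log_pos one_lt_two
  set c : ℝ := (K / Real.log 2 ^ 2) ^ ((1 : ℝ) / 3) with hc_def
  have hKl : 0 < K / Real.log 2 ^ 2 := by positivity
  have hc : 0 < c := Real.rpow_pos_of_pos hKl _
  have hc3 : c ^ 3 = K / Real.log 2 ^ 2 := by
    rw [hc_def, ← Real.rpow_natCast, ← Real.rpow_mul hKl.le]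
    norm_num
  refine ⟨c, hc, fun d hd n hn => h d n hd ?_⟩
  have hd0 : (0 : ℝ) ≤ d := Nat.cast_nonneg d
  -- `n ≥ c d^{5/3}`, hence `n³ ≥ c³ d⁵ = K d⁵ / log² 2`
  have hn' : c * (d : ℝ) ^ ((5 : ℝ) / 3) ≤ n := (Nat.le_ceil _).trans (by exact_mod_cast hn)
  have hcd : 0 ≤ c * (d : ℝ) ^ ((5 : ℝ) / 3) := by positivity
  have hd5 : ((d : ℝ) ^ ((5 : ℝ) / 3)) ^ 3 = (d : ℝ) ^ 5 := by
    rw [← Real.rpow_natCast, ← Real.rpow_mul hd0]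
    norm_num
  have hn3 : K / Real.log 2 ^ 2 * (d : ℝ) ^ 5 ≤ (n : ℝ) ^ 3 := by
    have := pow_le_pow_left₀ hcd hn' 3
    rwa [mul_pow, hc3, hd5] at this
  -- `log(n+2) ≥ log 2`
  have hlog : Real.log 2 ^ 2 ≤ Real.log ((n : ℝ) + 2) ^ 2 := by
    have h2 : Real.log 2 ≤ Real.log ((n : ℝ) + 2) :=
      Real.log_le_log two_pos (by linarith [Nat.cast_nonneg (α := ℝ) n])
    exact pow_le_pow_left₀ hl2.le h2 2
  calc K * (d : ℝ) ^ 5 = K / Real.log 2 ^ 2 * (d : ℝ) ^ 5 * Real.log 2 ^ 2 := by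
        field_simp
    _ ≤ (n : ℝ) ^ 3 * Real.log ((n : ℝ) + 2) ^ 2 :=
        mul_le_mul hn3 hlog (by positivity) (by positivity)

end Literature.NumberTheory.LFunctions

end
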